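import Summits.QuantumFields.YangMills.Theorems.CurvatureSandwichBound.Negative.Inhabitants

/-!
# `CurvatureSandwichBound` (Σ) — negative-side support III: the sup-norm-only strengthening is FALSE; the constant is
not uniform in the family

Support file for crux `stmt-QuantumFields-18372` (refuter, cdisprove), extracted from the work file
`Cruxes/CurvatureSandwichBound/Disproof.lean`.  Tree objects only; nothing is posited.

* `SandwichBoundSup S₁ h μ C` — the row-block of Σ with the `L¹`-mass `Mh` of the transverse profile `hh` DROPPED from
  the constant (pure sup-norm control `C·Mg·Mh'·(u^{-μ}+v^{-μ})`, an `L∞`-type H-bound in the transverse directions);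
  every hypothesis of the row kept verbatim.
* `not_sandwichBoundSup_constField_one`, `not_exists_sandwichBoundSup_constField_one`: it FAILS for the constant field
  `κ = 1` (`DiagonalMirrorRPR.Negative.constField`; on paper the `β ≡ 0` Wilson limit with `c_k(6d₀ − m_k) → 1`), every
  `μ`, every `C`: insertions `f₁ = g ⊗ hh_L` with `hh_L` a plateau of half-side `L` (`Mh' = 1`,
  `|∫ f₁| = ∫g·(∫ b_L)² ≥ 4L² ∫g`) against the degree-`0` state `W ≡ 1` at `u = v = 1`.  So the `L¹` term of Σ's
  constant is load-bearing: Σ is an `L¹ ∩ L∞`-smearing bound, not an `L∞` H-bound.  (On paper the `L∞` term is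
  load-bearing too — with `Mh` alone the vacuum row of a dimension-4 kernel forces `μ ≥ 4` — see the work file.)
* `not_exists_uniform_sandwichBound_constField`: Σ's own rows cannot hold with a constant uniform in the family
  (constant fields: `C ≥ c₀|κ|`); the crux correctly puts `∃ μ C` inside `∀ G r sch S₁`.
* The witness (`SupWitness.*`): product bumps `g(t,x¹) = b_t(t) b_x(x¹)` with times in `(1,2)`, `hh_L(x²,x³) =
  b_L(x²) b_L(x³)`, the Schwartz insertion `f₁ = g ⊗ hh_L` on `(ℝ⁴)¹` (compact support), its time-ordering in degree
  `1 + 0`, and its integrals (`∫ f₁ = ∫g · ∫hh_L`, planar/transverse Fubini).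
-/

noncomputable section

namespace Summit.QuantumFields.YangMills.Theorems.CurvatureSandwichBound.Negative

open scoped BigOperators SchwartzMap ComplexConjugate InnerProductSpace ENNReal
open MeasureTheory Filter Topology Complex
open Literature.MathematicalPhysics.QuantumLattice Literature.MathematicalPhysics.AQFT
  Literature.MathematicalPhysics.QuantumFieldTheory
open Summit.QuantumFields.YangMills.Theorems.NPointIsotropy.Negative (E4)
open Summit.QuantumFields.YangMills.Theorems.DiagonalMirrorRPR.Negative
  (constField constField_apply integral_appendTensor)
open Summit.QuantumFields.YangMills.Theorems.NPointIsotropy.ComplexRotationBandlimit.SandwichVacuumRow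
  (exists_planarTransverseSplit)

/-! ## §1 The strengthened row-block -/

/-- **The row-block with the `L¹`-mass `Mh` of the transverse profile DROPPED from the constant**: same
hypotheses as `SandwichBound`, right-hand side `C · Mg · Mh' · (u^{-μ} + v^{-μ}) · ‖Ψ_W‖` (an `L∞`-type
H-bound in the transverse directions). -/
def SandwichBoundSup (S₁ : SchwingerFamily E4) (h : OSReconstructionNoE1 S₁.toLabelled) (μ C : ℝ) : Prop :=
  ∀ (u v : ℝ), 0 < u → 0 < v → u ≤ 1 → v ≤ 1 →
  ∀ (f₁ : SchwartzMap (Fin 1 → E4) ℂ) (g hh : ℝ × ℝ → ℂ) (Mg Mh Mh' : ℝ),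
    (∀ x : Fin 1 → E4, f₁ x = g (x 0 0, x 0 1) * hh (x 0 2, x 0 3)) →
    (∀ p : ℝ × ℝ, g p ≠ 0 → u ≤ p.1 ∧ p.1 ≤ 2 * u) →
    MeasureTheory.Integrable g → (∫ p, ‖g p‖) ≤ Mg →
    MeasureTheory.Integrable hh → (∫ p, ‖hh p‖) ≤ Mh → (∀ p, ‖hh p‖ ≤ Mh') →
  ∀ (n : ℕ) (W : SchwartzMap (Fin n → E4) ℂ) (hW : IsTimeOrdered W)
    (hFW : IsTimeOrdered
      (SchwartzMap.appendTensor f₁ (translateMulti ((2 * u + v) • EuclideanSpace.single 0 1) W))),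
    ‖h.fieldVec (1 + n) (fun _ => ())
        (SchwartzMap.appendTensor f₁ (translateMulti ((2 * u + v) • EuclideanSpace.single 0 1) W)) hFW‖ ≤
      C * Mg * Mh' * (u ^ (-μ) + v ^ (-μ)) * ‖h.fieldVec n (fun _ => ()) W hW‖

namespace SupWitness

/-! ### The witness: `f₁ = g ⊗ hh_L`, `g` a bump with times in `[1,2]`, `hh_L` a plateau of half-side `L` -/

/-- Time profile: a bump at `t = 3/2` with plateau radius `1/4`, support radius `1/2` (so times lie in `(1,2)`). -/
def bt : ContDiffBump (3 / 2 : ℝ) := ⟨1 / 4, 1 / 2, by norm_num, by norm_num⟩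

/-- `x¹`-profile: any bump. -/
def bx : ContDiffBump (0 : ℝ) := ⟨1, 2, by norm_num, by norm_num⟩

variable {L : ℝ} (hL : 0 < L)

/-- Transverse profile: plateau of radius `L` (value `1` on `[-L, L]`), support radius `L + 1`. -/
def bL (hL : 0 < L) : ContDiffBump (0 : ℝ) := ⟨L, L + 1, hL, by linarith⟩

/-- `g(t, x¹) = bt(t) bx(x¹)`. -/
def g (p : ℝ × ℝ) : ℂ := (bt p.1 : ℂ) * (bx p.2 : ℂ)

/-- `hh_L(x², x³) = bL(x²) bL(x³)`. -/
def hh (hL : 0 < L) (q : ℝ × ℝ) : ℂ := (bL hL q.1 : ℂ) * (bL hL q.2 : ℂ)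

/-- The raw insertion `x ↦ g(x⁰,x¹) hh_L(x²,x³)` on `(ℝ⁴)¹`. -/
def raw (hL : 0 < L) (x : Fin 1 → E4) : ℂ := g (x 0 0, x 0 1) * hh hL (x 0 2, x 0 3)

/-- Where `g ≠ 0`: times in `(1,2)`, `|x¹| < 2`. -/
theorem g_ne_zero {p : ℝ × ℝ} (hp : g p ≠ 0) : 1 < p.1 ∧ p.1 < 2 ∧ |p.2| < 2 := by
  have h1 : bt p.1 ≠ 0 := fun h => hp (by simp [g, h])
  have h2 : bx p.2 ≠ 0 := fun h => hp (by simp [g, h])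
  have h1' : p.1 ∈ Function.support bt := h1
  have h2' : p.2 ∈ Function.support bx := h2
  rw [ContDiffBump.support_eq, Metric.mem_ball, Real.dist_eq] at h1' h2'
  simp only [bt, bx, sub_zero] at h1' h2'
  rw [abs_lt] at h1'
  exact ⟨by linarith [h1'.1], by linarith [h1'.2], h2'⟩

include hL in
/-- Where `hh_L ≠ 0`: `|x²|, |x³| < L + 1`. -/
theorem hh_ne_zero {q : ℝ × ℝ} (hq : hh hL q ≠ 0) : |q.1| < L + 1 ∧ |q.2| < L + 1 := by
  have h1 : bL hL q.1 ≠ 0 := fun h => hq (by simp [hh, h])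
  have h2 : bL hL q.2 ≠ 0 := fun h => hq (by simp [hh, h])
  have h1' : q.1 ∈ Function.support (bL hL) := h1
  have h2' : q.2 ∈ Function.support (bL hL) := h2
  rw [ContDiffBump.support_eq, Metric.mem_ball, Real.dist_eq, sub_zero] at h1' h2'
  exact ⟨h1', h2'⟩

/-- The coordinate box `{y : |yᵢ| ≤ M}` of `ℝ⁴` is compact. -/
theorem isCompact_box (M : ℝ) : IsCompact {y : E4 | ∀ i, |y i| ≤ M} := by
  have h : {y : E4 | ∀ i, |y i| ≤ M} =
      (EuclideanSpace.equiv (Fin 4) ℝ).toHomeomorph ⁻¹' (Set.univ.pi fun _ : Fin 4 => Set.Icc (-M) M) := by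
    ext y
    simp only [Set.mem_setOf_eq, Set.mem_preimage, Set.mem_univ_pi, Set.mem_Icc, abs_le]
    rfl
  rw [h]
  exact ((EuclideanSpace.equiv (Fin 4) ℝ).toHomeomorph.isCompact_preimage).2
    (isCompact_univ_pi fun _ => isCompact_Icc)

include hL in
/-- Where the raw insertion is non-zero all four coordinates are bounded by `L + 3`. -/
theorem raw_ne_zero {x : Fin 1 → E4} (hx : raw hL x ≠ 0) : ∀ i : Fin 4, |x 0 i| ≤ L + 3 := by
  have hg0 : g (x 0 0, x 0 1) ≠ 0 := left_ne_zero_of_mul hx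
  have hh0 : hh hL (x 0 2, x 0 3) ≠ 0 := right_ne_zero_of_mul hx
  obtain ⟨h00, h01, h02⟩ := g_ne_zero hg0
  obtain ⟨h03, h04⟩ := hh_ne_zero hL hh0
  intro i
  fin_cases i
  · show |x 0 0| ≤ L + 3
    rw [abs_le]; constructor <;> linarith
  · show |x 0 1| ≤ L + 3
    linarith [h02]
  · show |x 0 2| ≤ L + 3
    linarith [h03]
  · show |x 0 3| ≤ L + 3
    linarith [h04]

include hL in
/-- The raw insertion has compact support. -/
theorem hasCompactSupport_raw : HasCompactSupport (raw hL) := by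
  refine HasCompactSupport.intro (isCompact_univ_pi fun _ : Fin 1 => isCompact_box (L + 3)) fun x hx => ?_
  by_contra hne
  apply hx
  intro j _
  rw [Subsingleton.elim j 0]
  exact raw_ne_zero hL hne

/-- Coordinates of the single point of `(ℝ⁴)¹` are smooth. -/
theorem contDiff_coord (i : Fin 4) : ContDiff ℝ (⊤ : ℕ∞) fun x : Fin 1 → E4 => x 0 i :=
  ((EuclideanSpace.proj i).contDiff.comp (contDiff_apply ℝ E4 (0 : Fin 1)))

include hL in
/-- The raw insertion is smooth. -/
theorem contDiff_raw : ContDiff ℝ (⊤ : ℕ∞) (raw hL) := by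
  have c0 := Complex.ofRealCLM.contDiff.comp (bt.contDiff.comp (contDiff_coord 0))
  have c1 := Complex.ofRealCLM.contDiff.comp (bx.contDiff.comp (contDiff_coord 1))
  have c2 := Complex.ofRealCLM.contDiff.comp ((bL hL).contDiff.comp (contDiff_coord 2))
  have c3 := Complex.ofRealCLM.contDiff.comp ((bL hL).contDiff.comp (contDiff_coord 3))
  exact (c0.mul c1).mul (c2.mul c3)

/-- **The insertion `f₁ = g ⊗ hh_L` as a Schwartz function.** -/
def f₁ (hL : 0 < L) : 𝓢((Fin 1 → E4), ℂ) := (hasCompactSupport_raw hL).toSchwartzMap (contDiff_raw hL)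

/-- Values of `f₁` (the factorisation hypothesis of the rows, by `rfl`). -/
theorem f₁_apply (x : Fin 1 → E4) : f₁ hL x = g (x 0 0, x 0 1) * hh hL (x 0 2, x 0 3) := rfl

/-- `g` is integrable. -/
theorem integrable_g : Integrable g :=
  (bt.integrable.ofReal (𝕜 := ℂ)).mul_prod (bx.integrable.ofReal (𝕜 := ℂ))

include hL in
/-- `hh_L` is integrable. -/
theorem integrable_hh : Integrable (hh hL) :=
  ((bL hL).integrable.ofReal (𝕜 := ℂ)).mul_prod ((bL hL).integrable.ofReal (𝕜 := ℂ))

include hL in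
/-- `|hh_L| ≤ 1` (so `Mh' = 1`). -/
theorem norm_hh_le (q : ℝ × ℝ) : ‖hh hL q‖ ≤ 1 := by
  rw [hh, norm_mul, Complex.norm_real, Complex.norm_real, Real.norm_of_nonneg (bL hL).nonneg,
    Real.norm_of_nonneg (bL hL).nonneg]
  exact mul_le_one₀ (bL hL).le_one (bL hL).nonneg (bL hL).le_one

/-- The time window of `g` is `[u, 2u]` with `u = 1`. -/
theorem g_window (p : ℝ × ℝ) (hp : g p ≠ 0) : (1 : ℝ) ≤ p.1 ∧ p.1 ≤ 2 * 1 := by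
  obtain ⟨h1, h2, -⟩ := g_ne_zero hp
  constructor <;> linarith

/-- The degree-`0` "state": the constant `1` on the one-point space `(ℝ⁴)⁰`. -/
def W0 : 𝓢((Fin 0 → E4), ℂ) := SchwartzMap.constOfSubsingleton (D := Fin 0 → E4) (1 : ℂ)

/-- The degree-`0` state is time-ordered (vacuously). -/
theorem isTimeOrdered_W0 : IsTimeOrdered W0 := fun _ _ => ⟨fun i => i.elim0, fun i => i.elim0⟩

/-- `∫_{(ℝ⁴)⁰} W = W()` (Lebesgue measure on the one-point space is the Dirac mass). -/
theorem integral_fin_zero (W : 𝓢((Fin 0 → E4), ℂ)) : ∫ x, W x = W default := by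
  rw [MeasureTheory.volume_pi, MeasureTheory.Measure.pi_of_empty (fun _ : Fin 0 => (volume : Measure E4)) default]
  exact integral_dirac _ _

/-- `∫ W0 = 1`. -/
theorem integral_W0 : ∫ x, W0 x = 1 := by
  rw [integral_fin_zero]
  rfl

include hL in
/-- Time-ordering of `f₁ ⊗ W_a` in degree `1 + 0`: the insertion's times lie in `[1, 2]`. -/
theorem isTimeOrdered_insertion (a : E4) :
    IsTimeOrdered (SchwartzMap.appendTensor (f₁ hL) (translateMulti a W0)) := by
  intro x hx
  obtain ⟨hA, -⟩ := OSReconstructionNoE1.tsupport_appendTensor_subset _ _ hx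
  have hcl : tsupport ((f₁ hL : 𝓢((Fin 1 → E4), ℂ)) : (Fin 1 → E4) → ℂ) ⊆ {y | 1 ≤ y 0 0} := by
    refine closure_minimal (fun y hy => ?_) (isClosed_le continuous_const
      ((EuclideanSpace.proj (0 : Fin 4)).continuous.comp (continuous_apply 0)))
    exact (g_window _ (left_ne_zero_of_mul (Function.mem_support.1 hy))).1
  have h1 : (1 : ℝ) ≤ x (Fin.castAdd 0 0) 0 := hcl hA
  refine ⟨fun i => ?_, fun i j hij => ?_⟩
  · have hi : i = Fin.castAdd 0 0 := Fin.ext (by have := i.isLt; simp only [Fin.val_castAdd, Fin.val_zero]; omega)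
    rw [hi]
    linarith
  · exfalso
    have h' : (i : ℕ) < j := hij
    have := i.isLt
    have := j.isLt
    omega

/-! ### Integrals of the witness -/

/-- `∫_{(ℝ⁴)¹} g ⊗ hh = ∫ g · ∫ hh` (Bochner version of the planar/transverse split). -/
theorem integral_f₁ : ∫ x, f₁ hL x = (∫ p, g p) * ∫ q, hh hL q := by
  obtain ⟨e, he, hex⟩ := exists_planarTransverseSplit
  have h1 : ∫ x : Fin 1 → E4, f₁ hL x = ∫ y : E4, g (y 0, y 1) * hh hL (y 2, y 3) := by
    rw [← (volume_preserving_funUnique (Fin 1) E4).integral_comp'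
      (fun y : E4 => g (y 0, y 1) * hh hL (y 2, y 3))]
    rfl
  have h2 : ∫ y : E4, g (y 0, y 1) * hh hL (y 2, y 3) =
      ∫ z : (ℝ × ℝ) × (ℝ × ℝ), g z.1 * hh hL z.2 := by
    rw [← he.integral_comp' (fun z : (ℝ × ℝ) × (ℝ × ℝ) => g z.1 * hh hL z.2)]
    refine integral_congr_ae (Filter.Eventually.of_forall fun y => ?_)
    simp only [hex]
  rw [h1, h2]
  exact integral_prod_mul (μ := (volume : Measure (ℝ × ℝ))) (ν := (volume : Measure (ℝ × ℝ))) g (hh hL)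

/-- `∫ g = ∫ b_t · ∫ b_x`. -/
theorem integral_g : ∫ p, g p = (((∫ s, bt s) * ∫ t, bx t : ℝ) : ℂ) := by
  have h := integral_prod_mul (μ := (volume : Measure ℝ)) (ν := (volume : Measure ℝ))
    (fun s : ℝ => (bt s : ℂ)) (fun t : ℝ => (bx t : ℂ))
  rw [integral_complex_ofReal, integral_complex_ofReal] at h
  push_cast
  exact h

include hL in
/-- `∫ hh_L = (∫ b_L)²`. -/
theorem integral_hh : ∫ q, hh hL q = (((∫ s, bL hL s) ^ 2 : ℝ) : ℂ) := by
  have h := integral_prod_mul (μ := (volume : Measure ℝ)) (ν := (volume : Measure ℝ))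
    (fun s : ℝ => (bL hL s : ℂ)) (fun t : ℝ => (bL hL t : ℂ))
  rw [integral_complex_ofReal] at h
  push_cast
  rw [sq]
  exact h

/-- `∫ |g| = ∫ b_t · ∫ b_x` (`g ≥ 0`). -/
theorem integral_norm_g : ∫ p, ‖g p‖ = (∫ s, bt s) * ∫ t, bx t := by
  have h : (fun p : ℝ × ℝ => ‖g p‖) = fun p => (fun s : ℝ => bt s) p.1 * (fun t : ℝ => bx t) p.2 := by
    funext p
    rw [g, norm_mul, Complex.norm_real, Complex.norm_real, Real.norm_of_nonneg bt.nonneg,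
      Real.norm_of_nonneg bx.nonneg]
  rw [h]
  exact integral_prod_mul (μ := (volume : Measure ℝ)) (ν := (volume : Measure ℝ)) _ _

include hL in
/-- `∫ bL ≥ 2L` (the plateau). -/
theorem two_mul_le_integral_bL : 2 * L ≤ ∫ s, bL hL s := by
  have h := (bL hL).measure_closedBall_le_integral (μ := volume)
  rwa [show (bL hL).rIn = L from rfl, Real.volume_real_closedBall hL.le] at h

end SupWitness

open SupWitness in
/-- **Theorem (the sup-norm-only strengthening is false, already for the constant field `κ = 1`).**  For the
`e₀`-reconstruction of `constField 1` NO exponent `μ` and NO constant `C` give `SandwichBoundSup`: with `u = v = 1`,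
the degree-`0` state `W ≡ 1` and the insertions `f₁ = g ⊗ hh_L` (`Mh' = 1`), the left-hand side is
`|∫ f₁| = ∫g · (∫ bL)² ≥ ∫g · 4L²` while the right-hand side is `2 C ∫g` — false for `L = |C| + 1`.  Hence the `L¹`
mass `Mh` in Σ's constant is load-bearing (c-number limits already need it). -/
theorem not_sandwichBoundSup_constField_one (μ C : ℝ) :
    ¬ SandwichBoundSup (constField 1) (osReconstruction_constField 1) μ C := by
  intro hS
  set L : ℝ := |C| + 1 with hLdef
  have hL : 0 < L := by positivity
  have key := hS 1 1 one_pos one_pos le_rfl le_rfl (f₁ hL) g (hh hL) (∫ p, ‖g p‖) (∫ q, ‖hh hL q‖) 1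
    (f₁_apply hL) g_window integrable_g le_rfl (integrable_hh hL) le_rfl (norm_hh_le hL) 0 W0 isTimeOrdered_W0
    (isTimeOrdered_insertion hL _)
  rw [norm_fieldVec_constField, norm_fieldVec_constField,
    integral_appendTensor (isAppendTensorOf_appendTensor _ _), integral_translateMulti, integral_W0, mul_one,
    integral_f₁, integral_g, integral_hh hL, integral_norm_g, Real.one_rpow] at key
  simp only [abs_one, one_pow, one_mul, norm_one, mul_one] at key
  rw [← Complex.ofReal_mul, Complex.norm_real, Real.norm_of_nonneg (mul_nonneg
    (mul_nonneg (integral_nonneg bt.nonneg') (integral_nonneg bx.nonneg')) (sq_nonneg _))] at key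
  -- key : (∫bt ∫bx) (∫bL)² ≤ C * (∫bt ∫bx) * (1 + 1)
  have hA : 0 < (∫ s, bt s) * ∫ t, bx t := mul_pos bt.integral_pos bx.integral_pos
  have hB : 2 * L ≤ ∫ s, bL hL s := two_mul_le_integral_bL hL
  have hB2 : (2 * L) ^ 2 ≤ (∫ s, bL hL s) ^ 2 := pow_le_pow_left₀ (by linarith) hB 2
  have h1 : (∫ s, bL hL s) ^ 2 ≤ 2 * C := by nlinarith
  have h2 : C ≤ |C| := le_abs_self C
  nlinarith

/-- **Corollary: `∃ μ < 4, ∃ C, SandwichBoundSup` fails for `constField 1`** — a family meeting the eight-frame RP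
(`constField_pullback_isReflectionPositive`), the soft kernel (`K ≡ 1`), the planar cone (constant `Φ`) and both
rows of Σ itself (`conclusion_constField`); on paper it is moreover the `β ≡ 0` Wilson limit with `c_k(6d₀ − m_k) → 1`
(landed `tie_beta_zero_factorises`), i.e. a TIED family: the strengthened crux would be refuted by lattice
Yang–Mills at infinite coupling. -/
theorem not_exists_sandwichBoundSup_constField_one :
    ¬ ∃ μ C : ℝ, μ < 4 ∧ SandwichBoundSup (constField 1) (osReconstruction_constField 1) μ C :=
  fun ⟨μ, C, _, h⟩ => not_sandwichBoundSup_constField_one μ C h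


open SupWitness in
/-- **Σ's constant cannot be uniform over the family** (not even over the constant fields): at `κ`, `u = v = 1`,
`W ≡ 1`, `f₁ = g ⊗ hh_1`, the row reads `|κ| ∫g (∫ b₁)² ≤ 2 C ∫g (∫|hh_1| + 1)` — false for
`κ = |C| (∫|hh_1| + 1) + 1`.  (Information for planners: `∃ μ C` sits correctly INSIDE `∀ G r sch S₁`; a
strengthening with `C` depending on `G` alone would be refuted by the `β ≡ 0` limits with large `c_k`.) -/
theorem not_exists_uniform_sandwichBound_constField :
    ¬ ∃ μ C : ℝ, ∀ κ : ℝ, SandwichBound (constField κ) (osReconstruction_constField κ) μ C := by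
  rintro ⟨μ, C, hS⟩
  have hL : (0 : ℝ) < 1 := one_pos
  set M : ℝ := ∫ q, ‖hh hL q‖ with hMdef
  have hM : 0 ≤ M := integral_nonneg fun _ => norm_nonneg _
  set κ : ℝ := |C| * (M + 1) + 1 with hκdef
  have hκ : 0 < κ := by positivity
  have key := hS κ 1 1 one_pos one_pos le_rfl le_rfl (f₁ hL) g (hh hL) (∫ p, ‖g p‖) M 1
    (f₁_apply hL) g_window integrable_g le_rfl (integrable_hh hL) le_rfl (norm_hh_le hL) 0 W0 isTimeOrdered_W0
    (isTimeOrdered_insertion hL _)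
  rw [norm_fieldVec_constField, norm_fieldVec_constField,
    integral_appendTensor (isAppendTensorOf_appendTensor _ _), integral_translateMulti, integral_W0, mul_one,
    integral_f₁, integral_g, integral_hh hL, integral_norm_g, Real.one_rpow] at key
  simp only [add_zero, pow_one, pow_zero, norm_one, mul_one] at key
  rw [← Complex.ofReal_mul, Complex.norm_real, Real.norm_of_nonneg (mul_nonneg
    (mul_nonneg (integral_nonneg bt.nonneg') (integral_nonneg bx.nonneg')) (sq_nonneg _)),
    abs_of_pos hκ] at key
  -- key : κ * ((∫bt ∫bx) (∫bL)²) ≤ C * (∫bt ∫bx) * (M + 1) * (1 + 1)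
  have hA : 0 < (∫ s, bt s) * ∫ t, bx t := mul_pos bt.integral_pos bx.integral_pos
  have hB : 2 * 1 ≤ ∫ s, bL hL s := two_mul_le_integral_bL hL
  have hB2 : (2 * 1) ^ 2 ≤ (∫ s, bL hL s) ^ 2 := pow_le_pow_left₀ (by norm_num) hB 2
  have h1 : κ * (∫ s, bL hL s) ^ 2 ≤ 2 * C * (M + 1) := by nlinarith
  have h2 : C ≤ |C| := le_abs_self C
  have h3 : 4 * κ ≤ 2 * C * (M + 1) := by nlinarith
  nlinarith [abs_nonneg C]

end Summit.QuantumFields.YangMills.Theorems.CurvatureSandwichBound.Negative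

end
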